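import Literature.Algebra.Lie.SpecialLinearAutomorphismsClassification
import HarnessLib

/-!
# Automorphisms of `𝔰𝔩ₙ`, VI: isomorphisms `𝔰𝔩ₙ ≅ 𝔰𝔩ₘ` between two index types
# (Jacobson, *Lie Algebras*, Ch. IX §5 Theorem 5, transported along `reindex`)

Topic `Algebra/Lie`. Cell `hodge-nonav`, route `Summits/HodgeConjecture/HodgeConjecture/Theses/CyclicUnitaryPowers.lean`,
crux K1 (stmt-HodgeConjecture-19544), roadmap `HOME/memos/GKR-CORE-ROADMAP-Ax-g2.md` step C5 — consumer form for the
Goursat–Kolchin–Ribet assembly, where the Lie isomorphism `𝔰𝔩(E_j) ≅ 𝔰𝔩(E_{i₀})` arrives between matrix algebras of two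
a priori different index types (bases of `E_j`, `E_{i₀}`).

* `exists_equiv_conj_or_conj_transpose` (the one public result) — **Theorem 5 for `ψ : sl n K ≃ₗ⁅K⁆ sl m K`** (`K` algebraically closed of
  characteristic zero, `|n| ≥ 2`): for some bijection `e : n ≃ m` and `P, Q` with `PQ = QP = 1`, either
  `ψ(X) = P · reindex e e X · Q` for all `X`, or `ψ(X) = −P · (reindex e e X)ᵀ · Q` for all `X` (part V composed with
  the Lie isomorphism `𝔰𝔩ₙ ≅ 𝔰𝔩ₘ` induced by `Matrix.reindexLieEquiv e`, which preserves traces).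
Private helpers: `finrank_sl_add_one` (`dim 𝔰𝔩ₙ + 1 = |n|²`) and `card_eq_of_lieEquiv` (`𝔰𝔩ₙ ≅ 𝔰𝔩ₘ`, `|n| ≥ 2` ⇒
`|n| = |m|`) re-prove, privately, statements that also exist under `Literature/AlgebraicGeometry/HodgeTheory/`
(`GoursatKolchinRibetLieAlgebra.finrank_sl`, `exists_lieHom_sl_reindex`; the inline cardinality argument of
`GoursatKolchinRibetLieCore`) — that layer imports this one, not conversely, so they are not imported here; a librarian
may later redirect the HodgeTheory copies to this file.  Everything is PROVED (0 `sorry`, no new definition, no named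
fact).

## References

* [Jacobson1962LieAlgebras] N. Jacobson, *Lie Algebras*, Ch. IX §5 Theorem 5 (held: galaxy panama:489961279193147).
* [Humphreys1972] J. E. Humphreys, *Introduction to Lie Algebras and Representation Theory*, §1.2 (`dim A_l`).
-/

attribute [local instance 100] LieRing.ofAssociativeRing

namespace Literature.Algebra.Lie.SpecialLinearAutomorphisms

open LieAlgebra LieAlgebra.SpecialLinear Matrix Module

variable {n m : Type*} [Fintype n] [DecidableEq n] [Fintype m] [DecidableEq m] {K : Type*} [Field K]

/-- The dimension of `𝔰𝔩ₙ(K)` is `|n|² − 1` for non-empty `n` (private copy of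
`Literature.AlgebraicGeometry.HodgeTheory.…finrank_sl`, which this layer cannot import). [folklore] -/
private theorem finrank_sl_add_one [Nonempty n] : finrank K (sl n K) + 1 = Fintype.card n * Fintype.card n := by
  classical
  have hker : (sl n K).toSubmodule = LinearMap.ker (Matrix.traceLinearMap n K K) := rfl
  have hsurj : Function.Surjective (Matrix.traceLinearMap n K K) := by
    intro c
    obtain ⟨i⟩ := ‹Nonempty n›
    exact ⟨Matrix.single i i c, by simp [Matrix.traceLinearMap_apply]⟩
  have hrange : finrank K (LinearMap.range (Matrix.traceLinearMap n K K)) = 1 := by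
    rw [LinearMap.range_eq_top.2 hsurj, finrank_top, Module.finrank_self]
  have h := LinearMap.finrank_range_add_finrank_ker (Matrix.traceLinearMap n K K)
  rw [hrange, Module.finrank_matrix, Module.finrank_self, mul_one, add_comm] at h
  change finrank K (sl n K).toSubmodule + 1 = _
  rw [hker]
  simpa using h

/-- A Lie algebra isomorphism `𝔰𝔩ₙ ≅ 𝔰𝔩ₘ` with `|n| ≥ 2` forces `|n| = |m|` (private helper; the same inline
argument appears in `GoursatKolchinRibetLieCore`). [folklore] -/
private theorem card_eq_of_lieEquiv (hn : 1 < Fintype.card n) (ψ : sl n K ≃ₗ⁅K⁆ sl m K) :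
    Fintype.card n = Fintype.card m := by
  classical
  haveI : Nonempty n := Fintype.card_pos_iff.1 (by omega)
  have hdim : finrank K (sl n K) = finrank K (sl m K) := ψ.toLinearEquiv.finrank_eq
  have h1 := finrank_sl_add_one (n := n) (K := K)
  rcases isEmpty_or_nonempty m with hm | hm
  · -- `𝔰𝔩ₘ = 0` but `dim 𝔰𝔩ₙ ≥ 3`
    haveI : Subsingleton (sl m K) := ⟨fun x y => Subtype.ext (Matrix.ext fun a _ => isEmptyElim a)⟩
    have h0 : finrank K (sl m K) = 0 := Module.finrank_zero_of_subsingleton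
    rw [h0] at hdim
    rw [hdim, zero_add] at h1
    nlinarith
  · have h2 := finrank_sl_add_one (n := m) (K := K)
    rw [hdim] at h1
    rw [h1] at h2
    exact Nat.mul_self_inj.1 h2

omit [DecidableEq n] [DecidableEq m] in
/-- Traces are invariant under `reindex` along an equivalence. [folklore] -/
private theorem trace_reindex (e : n ≃ m) (X : Matrix n n K) : (Matrix.reindex e e X).trace = X.trace := by
  simp only [Matrix.trace, Matrix.diag_apply, Matrix.reindex_apply, Matrix.submatrix_apply]
  exact e.symm.sum_comp (fun i => X i i)

/-- `reindex` maps `𝔰𝔩ₙ` onto `𝔰𝔩ₘ`. [folklore] -/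
private theorem map_sl_reindexLieEquiv (e : n ≃ m) :
    (sl n K).map (Matrix.reindexLieEquiv e).toLieHom = sl m K := by
  ext Y
  rw [LieSubalgebra.mem_map]
  constructor
  · rintro ⟨X, hX, rfl⟩
    change (Matrix.reindexLieEquiv e X).trace = 0
    rw [Matrix.reindexLieEquiv_apply, trace_reindex]
    exact hX
  · intro hY
    refine ⟨Matrix.reindex e.symm e.symm Y, ?_, ?_⟩
    · change (Matrix.reindex e.symm e.symm Y).trace = 0
      rw [trace_reindex]
      exact hY
    · change Matrix.reindexLieEquiv e (Matrix.reindex e.symm e.symm Y) = Y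
      rw [Matrix.reindexLieEquiv_apply, Matrix.reindex_apply, Matrix.reindex_apply, Matrix.submatrix_submatrix,
        Equiv.symm_symm, Equiv.self_comp_symm, Matrix.submatrix_id_id]

/-- The Lie algebra isomorphism `𝔰𝔩ₙ ≅ 𝔰𝔩ₘ` induced by an equivalence `n ≃ m` of index types, with its action
`X ↦ reindex e e X`. [folklore] -/
private theorem exists_lieEquiv_reindex (e : n ≃ m) :
    ∃ ρ : sl n K ≃ₗ⁅K⁆ sl m K, ∀ x : sl n K, (ρ x : Matrix m m K) = Matrix.reindex e e (x : Matrix n n K) :=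
  ⟨LieEquiv.ofSubalgebras _ _ (Matrix.reindexLieEquiv e) (map_sl_reindexLieEquiv e), fun _ => rfl⟩

/-- **Jacobson's Theorem 5 for two index types.** A Lie algebra isomorphism `ψ : 𝔰𝔩ₙ(K) ≅ 𝔰𝔩ₘ(K)` (`K`
algebraically closed of characteristic zero, `|n| ≥ 2`) is, for some bijection `e : n ≃ m` and invertible `P`
(`Q = P⁻¹`), either `X ↦ P · reindex(X) · Q` or `X ↦ −P · reindex(X)ᵀ · Q`.
[cite: Jacobson1962LieAlgebras, Ch. IX §5 Theorem 5] -/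
theorem exists_equiv_conj_or_conj_transpose [IsAlgClosed K] [CharZero K] (hn : 1 < Fintype.card n)
    (ψ : sl n K ≃ₗ⁅K⁆ sl m K) :
    ∃ (e : n ≃ m) (P Q : Matrix m m K), P * Q = 1 ∧ Q * P = 1 ∧
      ((∀ x : sl n K, (ψ x : Matrix m m K) = P * Matrix.reindex e e (x : Matrix n n K) * Q) ∨
       (∀ x : sl n K, (ψ x : Matrix m m K) = -(P * (Matrix.reindex e e (x : Matrix n n K))ᵀ * Q))) := by
  classical
  have hcard := card_eq_of_lieEquiv hn ψ
  let e : n ≃ m := Fintype.equivOfCardEq hcard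
  obtain ⟨ρ, hρ⟩ := exists_lieEquiv_reindex (K := K) e
  have hm : 1 < Fintype.card m := hcard ▸ hn
  obtain ⟨P, Q, hPQ, hQP, h⟩ := exists_conj_or_conj_transpose hm (ρ.symm.trans ψ)
  refine ⟨e, P, Q, hPQ, hQP, ?_⟩
  have hρψ : ∀ x : sl n K, (ρ.symm.trans ψ) (ρ x) = ψ x := fun x => by
    rw [LieEquiv.trans_apply, LieEquiv.symm_apply_apply]
  rcases h with h | h
  · left
    intro x
    rw [← hρψ, h, hρ]
  · right
    intro x
    rw [← hρψ, h, hρ]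


end Literature.Algebra.Lie.SpecialLinearAutomorphisms
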